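import Summits.SmoothPoincare4.SmoothPoincare4.Theorems.AcyclicBisectionExists.Negative.Witness
import Summits.SmoothPoincare4.SmoothPoincare4.Theorems.ContractibleTwistedDoubleStandard.Negative.DoubleBisection
import Literature.Topology.FourManifolds.GluingProofs
import Literature.Geometry.Symplectic.PlanarContactBoundary

/-!
# `AcyclicBisectionExists` — negative-side support (8): CONTACT TWISTED DOUBLES `W₁ ∪_ψ W₂`
# satisfy the ∃-body

§15 of the standing disprover's work file `Cruxes/AcyclicBisectionExists/Disproof.lean` (gen 3),
the constructive direction of the thesis' dictionary "acyclic Stein bisection along a common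
contact seam = contact twisted double of two ℚ-acyclic Stein fillings of one contact ℚHS³":

* `map_mfderiv_incl_boundaryPlaneField` — `dι` maps the induced boundary plane field
  `Literature.Geometry.Symplectic.boundaryPlaneField S.J b` (`PlanarContactBoundary.lean`: the
  complex tangencies `ξ = contactPlane S.J` pulled back along `d(b.incl)`) ONTO `ξ` (by (A2) of
  the sibling file);
* `steinBisection_of_twistedGlue` — a gluing `P = W₁ ∪_ψ W₂` of two compact Stein domains along a
  diffeomorphism `ψ : ∂W₁ ≅ ∂W₂` with `d(ι₂ ∘ ψ)(ξ₁') = ξ₂` (a contactomorphism of the unoriented,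
  un-co-oriented plane fields) satisfies the six point-set/contact hypotheses of the crux
  (chain rule along `jA ∘ ι₁ = jB ∘ ι₂ ∘ ψ`);
* `Witness.ofTwistedGlue`, `hasAcyclicSteinBisection_of_twistedGlue`,
  `exists_twistedGlue_hasAcyclicSteinBisection` — so the ∃-body HOLDS on every contact twisted
  double of ℚ-acyclic compact Stein domains (in particular on every cork twist `C ∪_τ C̄` by a
  contactomorphism `τ` of the Stein-induced plane field, the Gompf Q2.2 sector of the rigidity
  crux), whatever its diffeomorphism type.  `Doubles.lean` is the case `W₁ = W₂`, `ψ = id` (there `hψ` holds by `map_mfderiv_incl_boundaryPlaneField`).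
-/

noncomputable section

-- the prescribed namespace `Summit.<P>.<Sub>.…` duplicates `SmoothPoincare4` (P = Sub)
set_option linter.dupNamespace false

open scoped Manifold ContDiff Topology ContinuousMap
open Set Function CategoryTheory CategoryTheory.Limits
open Literature.Geometry.Symplectic Literature.AlgebraicTopology.SingularHomology

namespace Summit.SmoothPoincare4.SmoothPoincare4.Theorems.AcyclicBisectionExists.Negative

open Summit.SmoothPoincare4.SmoothPoincare4.Theses.ConvexBisection
open Literature.Topology.FourManifolds
open Summit.SmoothPoincare4.SmoothPoincare4.Theorems.ContractibleTwistedDoubleStandard.Negative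

section TwistedDoubles

variable {W₁ : Type} [TopologicalSpace W₁] [ChartedSpace (EuclideanHalfSpace 4) W₁]
  [IsManifold (𝓡∂ 4) ∞ W₁] [CompactSpace W₁]
  {W₂ : Type} [TopologicalSpace W₂] [ChartedSpace (EuclideanHalfSpace 4) W₂]
  [IsManifold (𝓡∂ 4) ∞ W₂] [CompactSpace W₂]
  {P : Type} [TopologicalSpace P] [ChartedSpace (EuclideanSpace ℝ (Fin 4)) P]

/-- `dι` maps the induced boundary plane ONTO the complex tangencies (`ξ ≤ T∂W = range dι`,
(A2) of the sibling file). [folklore] -/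
theorem map_mfderiv_incl_boundaryPlaneField (b : BoundaryData (𝓡∂ 4) W₁ (𝓡 3)) (S : SteinStructure W₁)
    (z : b.carrier) :
    Submodule.map (mfderiv (𝓡 3) (𝓡∂ 4) b.incl z).toLinearMap (boundaryPlaneField S.J b z) =
      contactPlane S.J (b.incl z) := by
  apply Submodule.map_comap_eq_self
  intro v hv
  obtain ⟨u, hu⟩ := exists_mfderiv_incl_eq b z (contactPlane_le_boundaryTangentSpace S.J _ hv)
  exact ⟨u, hu⟩

/-- **A gluing `W₁ ∪_ψ W₂` of two compact Stein domains along a diffeomorphism `ψ : ∂W₁ ≅ ∂W₂`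
carrying the induced plane field of `J₁` to that of `J₂` (a contactomorphism of the unoriented,
un-co-oriented complex tangencies) is a Stein bisection along a common contact seam** — the six
point-set / contact hypotheses of the crux for `(P; W₁, W₂; J₁, J₂; jA, jB)`.  The contact matching:
`d jA (ξ₁) = d jA (dι₁ ξ₁') = d(jA ∘ ι₁)(ξ₁') = d(jB ∘ ι₂ ∘ ψ)(ξ₁') = d jB (d(ι₂ ∘ ψ) ξ₁') = d jB (ξ₂)`.
[folklore] -/
theorem steinBisection_of_twistedGlue (b₁ : BoundaryData (𝓡∂ 4) W₁ (𝓡 3))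
    (b₂ : BoundaryData (𝓡∂ 4) W₂ (𝓡 3)) (S₁ : SteinStructure W₁) (S₂ : SteinStructure W₂)
    (ψ : b₁.carrier ≃ₘ⟮𝓡 3, 𝓡 3⟯ b₂.carrier)
    (hψ : ∀ z, Submodule.map (mfderiv (𝓡 3) (𝓡∂ 4) (b₂.incl ∘ ψ) z).toLinearMap (boundaryPlaneField S₁.J b₁ z) =
      contactPlane S₂.J (b₂.incl (ψ z)))
    {jA : W₁ → P} {jB : W₂ → P}
    (hA : Manifold.IsSmoothEmbedding (𝓡∂ 4) (𝓡 4) ∞ jA)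
    (hB : Manifold.IsSmoothEmbedding (𝓡∂ 4) (𝓡 4) ∞ jB) (hU : range jA ∪ range jB = univ)
    (hR : ∀ a a', jA a = jB a' ↔ ∃ z, a = b₁.incl z ∧ a' = b₂.incl (ψ z)) :
    Manifold.IsSmoothEmbedding (𝓡∂ 4) (𝓡 4) ∞ jA ∧ Manifold.IsSmoothEmbedding (𝓡∂ 4) (𝓡 4) ∞ jB ∧
      range jA ∪ range jB = univ ∧ range jA ∩ range jB = jA '' (𝓡∂ 4).boundary W₁ ∧
      range jA ∩ range jB = jB '' (𝓡∂ 4).boundary W₂ ∧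
      (∀ w₁ w₂, jA w₁ = jB w₂ →
        Submodule.map (mfderiv (𝓡∂ 4) (𝓡 4) jA w₁).toLinearMap (contactPlane S₁.J w₁) =
          Submodule.map (mfderiv (𝓡∂ 4) (𝓡 4) jB w₂).toLinearMap (contactPlane S₂.J w₂)) := by
  have hcomp : jA ∘ b₁.incl = jB ∘ (b₂.incl ∘ ψ) := funext fun z => (hR _ _).2 ⟨z, rfl, rfl⟩
  refine ⟨hA, hB, hU, ?_, ?_, ?_⟩
  · ext p
    constructor
    · rintro ⟨⟨a, rfl⟩, ⟨a', ha'⟩⟩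
      obtain ⟨z, rfl, -⟩ := (hR a a').1 ha'.symm
      exact ⟨b₁.incl z, b₁.incl_mem_boundary z, rfl⟩
    · rintro ⟨a, ha, rfl⟩
      rw [← b₁.range_incl] at ha
      obtain ⟨z, rfl⟩ := ha
      exact ⟨mem_range_self _, ⟨b₂.incl (ψ z), ((hR _ _).2 ⟨z, rfl, rfl⟩).symm⟩⟩
  · ext p
    constructor
    · rintro ⟨⟨a, ha⟩, ⟨a', rfl⟩⟩
      obtain ⟨z, -, rfl⟩ := (hR a a').1 ha
      exact ⟨b₂.incl (ψ z), b₂.incl_mem_boundary _, rfl⟩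
    · rintro ⟨a, ha, rfl⟩
      rw [← b₂.range_incl] at ha
      obtain ⟨z', rfl⟩ := ha
      obtain ⟨z, rfl⟩ := ψ.surjective z'
      exact ⟨⟨b₁.incl z, (hR _ _).2 ⟨z, rfl, rfl⟩⟩, mem_range_self _⟩
  · intro w₁ w₂ hw
    obtain ⟨z, rfl, rfl⟩ := (hR w₁ w₂).1 hw
    have hι₁ : MDifferentiableAt (𝓡 3) (𝓡∂ 4) b₁.incl z :=
      b₁.isSmoothEmbedding.contMDiff.mdifferentiableAt (by simp)
    have hι₂ψ : MDifferentiableAt (𝓡 3) (𝓡∂ 4) (b₂.incl ∘ ψ) z :=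
      ((b₂.isSmoothEmbedding.contMDiff.comp ψ.contMDiff).mdifferentiableAt (by simp))
    have hjA : MDifferentiableAt (𝓡∂ 4) (𝓡 4) jA (b₁.incl z) := hA.contMDiff.mdifferentiableAt (by simp)
    have hjB : MDifferentiableAt (𝓡∂ 4) (𝓡 4) jB ((b₂.incl ∘ ψ) z) :=
      hB.contMDiff.mdifferentiableAt (by simp)
    have eA := mfderiv_comp z hjA hι₁
    have eB := mfderiv_comp z hjB hι₂ψ
    have hAB : mfderiv (𝓡 3) (𝓡 4) (jA ∘ b₁.incl) z = mfderiv (𝓡 3) (𝓡 4) (jB ∘ (b₂.incl ∘ ψ)) z := by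
      rw [hcomp]
    have step1 : Submodule.map (mfderiv (𝓡∂ 4) (𝓡 4) jA (b₁.incl z)).toLinearMap (contactPlane S₁.J (b₁.incl z))
        = Submodule.map (mfderiv (𝓡∂ 4) (𝓡 4) jA (b₁.incl z)).toLinearMap
            (Submodule.map (mfderiv (𝓡 3) (𝓡∂ 4) b₁.incl z).toLinearMap (boundaryPlaneField S₁.J b₁ z)) := by
      rw [map_mfderiv_incl_boundaryPlaneField]
    have step2 : Submodule.map (mfderiv (𝓡∂ 4) (𝓡 4) jA (b₁.incl z)).toLinearMap
            (Submodule.map (mfderiv (𝓡 3) (𝓡∂ 4) b₁.incl z).toLinearMap (boundaryPlaneField S₁.J b₁ z))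
        = Submodule.map (mfderiv (𝓡 3) (𝓡 4) (jA ∘ b₁.incl) z).toLinearMap (boundaryPlaneField S₁.J b₁ z) := by
      rw [← Submodule.map_comp]
      exact (congrArg (fun T : TangentSpace (𝓡 3) z →L[ℝ] TangentSpace (𝓡 4) (jA (b₁.incl z)) =>
        Submodule.map T.toLinearMap (boundaryPlaneField S₁.J b₁ z)) eA).symm
    have step3 : Submodule.map (mfderiv (𝓡 3) (𝓡 4) (jA ∘ b₁.incl) z).toLinearMap (boundaryPlaneField S₁.J b₁ z)
        = Submodule.map (mfderiv (𝓡 3) (𝓡 4) (jB ∘ (b₂.incl ∘ ψ)) z).toLinearMap (boundaryPlaneField S₁.J b₁ z) :=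
      congrArg (fun T : TangentSpace (𝓡 3) z →L[ℝ] (EuclideanSpace ℝ (Fin 4)) =>
        Submodule.map T.toLinearMap (boundaryPlaneField S₁.J b₁ z)) hAB
    have step4 : Submodule.map (mfderiv (𝓡 3) (𝓡 4) (jB ∘ (b₂.incl ∘ ψ)) z).toLinearMap (boundaryPlaneField S₁.J b₁ z)
        = Submodule.map (mfderiv (𝓡∂ 4) (𝓡 4) jB ((b₂.incl ∘ ψ) z)).toLinearMap
            (Submodule.map (mfderiv (𝓡 3) (𝓡∂ 4) (b₂.incl ∘ ψ) z).toLinearMap (boundaryPlaneField S₁.J b₁ z)) := by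
      rw [← Submodule.map_comp]
      exact congrArg (fun T : TangentSpace (𝓡 3) z →L[ℝ] TangentSpace (𝓡 4) (jB ((b₂.incl ∘ ψ) z)) =>
        Submodule.map T.toLinearMap (boundaryPlaneField S₁.J b₁ z)) eB
    have step5 : Submodule.map (mfderiv (𝓡∂ 4) (𝓡 4) jB ((b₂.incl ∘ ψ) z)).toLinearMap
            (Submodule.map (mfderiv (𝓡 3) (𝓡∂ 4) (b₂.incl ∘ ψ) z).toLinearMap (boundaryPlaneField S₁.J b₁ z))
        = Submodule.map (mfderiv (𝓡∂ 4) (𝓡 4) jB (b₂.incl (ψ z))).toLinearMap (contactPlane S₂.J (b₂.incl (ψ z))) := by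
      rw [hψ z]; rfl
    exact step1.trans (step2.trans (step3.trans (step4.trans step5)))

/-- **Every contact twisted double is a witness of the crux's ∃-body minus acyclicity.** [folklore] -/
def Witness.ofTwistedGlue (b₁ : BoundaryData (𝓡∂ 4) W₁ (𝓡 3))
    (b₂ : BoundaryData (𝓡∂ 4) W₂ (𝓡 3)) (S₁ : SteinStructure W₁) (S₂ : SteinStructure W₂)
    (ψ : b₁.carrier ≃ₘ⟮𝓡 3, 𝓡 3⟯ b₂.carrier)
    (hψ : ∀ z, Submodule.map (mfderiv (𝓡 3) (𝓡∂ 4) (b₂.incl ∘ ψ) z).toLinearMap (boundaryPlaneField S₁.J b₁ z) =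
      contactPlane S₂.J (b₂.incl (ψ z)))
    (h : IsBoundaryGluing b₁ b₂ ψ (𝓡 4) P) : Witness P :=
  let jA := h.choose
  let jB := h.choose_spec.choose
  have H := steinBisection_of_twistedGlue b₁ b₂ S₁ S₂ ψ hψ h.choose_spec.choose_spec.1
    h.choose_spec.choose_spec.2.1 h.choose_spec.choose_spec.2.2.1 h.choose_spec.choose_spec.2.2.2
  { W₁ := W₁, W₂ := W₂, J₁ := S₁, J₂ := S₂, e₁ := jA, e₂ := jB,
    emb₁ := H.1, emb₂ := H.2.1, cover := H.2.2.1, inter₁ := H.2.2.2.1, inter₂ := H.2.2.2.2.1,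
    contact := H.2.2.2.2.2 }

/-- **The ∃-body HOLDS on every contact twisted double `W₁ ∪_ψ W₂` of two ℚ-acyclic compact Stein
domains** (`ψ : ∂W₁ ≅ ∂W₂` a diffeomorphism carrying the induced plane field of `J₁` to that of
`J₂`).  This is the constructive direction of the thesis' dictionary "acyclic Stein bisection =
contact twisted double of ℚ-acyclic Stein fillings of one contact ℚHS³": every such regluing —
in particular every cork twist `C ∪_τ C̄` by a contactomorphism `τ` of the Stein-induced structure
(Gompf arXiv:1603.05090 Q2.2 sector of the rigidity crux) — satisfies `AcyclicBisectionExists` at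
its own total space, whatever its diffeomorphism type. [folklore] -/
theorem hasAcyclicSteinBisection_of_twistedGlue (b₁ : BoundaryData (𝓡∂ 4) W₁ (𝓡 3))
    (b₂ : BoundaryData (𝓡∂ 4) W₂ (𝓡 3)) (S₁ : SteinStructure W₁) (S₂ : SteinStructure W₂)
    (ψ : b₁.carrier ≃ₘ⟮𝓡 3, 𝓡 3⟯ b₂.carrier)
    (hψ : ∀ z, Submodule.map (mfderiv (𝓡 3) (𝓡∂ 4) (b₂.incl ∘ ψ) z).toLinearMap (boundaryPlaneField S₁.J b₁ z) =
      contactPlane S₂.J (b₂.incl (ψ z)))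
    (hW₁ : ∀ k, 0 < k → IsZero (singularHomology ℚ ℚ W₁ k))
    (hW₂ : ∀ k, 0 < k → IsZero (singularHomology ℚ ℚ W₂ k))
    (h : IsBoundaryGluing b₁ b₂ ψ (𝓡 4) P) : HasAcyclicSteinBisection P :=
  ⟨Witness.ofTwistedGlue b₁ b₂ S₁ S₂ ψ hψ h, fun k hk => ⟨hW₁ k hk, hW₂ k hk⟩⟩

/-- **Existence form**: the contact twisted double `W₁ ∪_ψ W₂` exists as a closed smooth
4-manifold (tree `exists_isBoundaryGluing_holds`) and carries a ℚ-acyclic Stein bisection along a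
common contact seam. [folklore] -/
theorem exists_twistedGlue_hasAcyclicSteinBisection [T2Space W₁] [T2Space W₂]
    (b₁ : BoundaryData (𝓡∂ 4) W₁ (𝓡 3)) (b₂ : BoundaryData (𝓡∂ 4) W₂ (𝓡 3))
    (S₁ : SteinStructure W₁) (S₂ : SteinStructure W₂) (ψ : b₁.carrier ≃ₘ⟮𝓡 3, 𝓡 3⟯ b₂.carrier)
    (hψ : ∀ z, Submodule.map (mfderiv (𝓡 3) (𝓡∂ 4) (b₂.incl ∘ ψ) z).toLinearMap (boundaryPlaneField S₁.J b₁ z) =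
      contactPlane S₂.J (b₂.incl (ψ z)))
    (hW₁ : ∀ k, 0 < k → IsZero (singularHomology ℚ ℚ W₁ k))
    (hW₂ : ∀ k, 0 < k → IsZero (singularHomology ℚ ℚ W₂ k)) :
    ∃ (P : Type) (_ : TopologicalSpace P) (_ : T2Space P) (_ : SecondCountableTopology P)
      (_ : CompactSpace P) (_ : ChartedSpace (EuclideanSpace ℝ (Fin 4)) P) (_ : IsManifold (𝓡 4) ∞ P),
      IsBoundaryGluing b₁ b₂ ψ (𝓡 4) P ∧ HasAcyclicSteinBisection P := by
  obtain ⟨P, _, _, _, _, _, _, hP⟩ := exists_isBoundaryGluing_holds (bM := b₁) (bN := b₂) ψ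
  exact ⟨P, ‹_›, ‹_›, ‹_›, ‹_›, ‹_›, ‹_›, hP,
    hasAcyclicSteinBisection_of_twistedGlue b₁ b₂ S₁ S₂ ψ hψ hW₁ hW₂ hP⟩

end TwistedDoubles

end Summit.SmoothPoincare4.SmoothPoincare4.Theorems.AcyclicBisectionExists.Negative
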